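import Mathlib
import HarnessLib
import HarnessLib.Audit
import Summits.AtomisticToContinuum.Statement
import Summits.AtomisticToContinuum.Crystallization.Theses.BarlowBlindPricedRungs
import Literature.MathematicalPhysics.StatisticalMechanics.LennardJonesThermodynamicLimitProofs
import HarnessLib.Audit.Status.Attr

/-!
Route: DefectDensityDial

# Route DefectDensityDial — A defect-density dial splits the defective case of LJ crystallization;
one priced rung kills the dense side

It suffices to show X = P₀ ∧ P₂ ∧ D ∧ C ∧ U (decomp-a2c node N_C.F.1, lens 5 «finite/base range +
asymptotic regime + bridge»;
CHILD ROUTE refining `BarlowBlindPricedRungs:DefectiveCase` (stmt-AtomisticToContinuum-26211, the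
declared residual of the parent),
conjunct-level). For a sequence x of Lennard-Jones ground states let b_N(x) be the fraction of
particles i with
¬IsTwoShellGood (1/20) (47/50) 1 (x N) i (two-shell environment not 1/20-close to a Barlow pattern
at a scale in [47/50, 1]).
The parent's residual P₁ = DefectiveCase («b_N(x) ↛ 0 ⇒ x has periodic windows») is cut by a DENSITY
DIAL θ₀ = 1/2 and by
clean-window recurrence into D (DenseDefectiveCase, crux): b_N ≥ 1/2 frequently ⇒ periodic windows;
C (SparseCleanCase, crux):
b_N ↛ 0, b_N < 1/2 eventually, clean two-shell-good balls of every radius recur ⇒ periodic windows;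
U (SparseUniformCase, crux,
DECLARED RESIDUAL): b_N ↛ 0, b_N < 1/2 eventually, no recurrent clean balls of some radius ⇒
periodic windows. By excluded middle
per sequence P₁ ⟺ D ∧ C ∧ U (kernel `defectiveCase_iff_pieces`, node file
HOME/decomp-a2c-lens-5/g3/DefectDensityDial.lean, which
imports the parent route module so the identity is about item 26211 itself); with the parent's
shared binders P₀ (FractionsFrameAlong,
support) and P₂ (StrainedCase, crux) the parent's certified `closes` gives Crystallization. Every
open piece is a kernel consequence
of P₁, hence of Crystallization (via hullCriterionConverse as in the parent), and the three classes
of sequences are pairwise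
disjoint, so each piece is strictly WEAKER than P₁. The named sufficient condition of D is ONE
priced finite-radius energy-splitting
rung with deficit/price ratio ε/κ < 1/2 (kernel door `dense_of_onePricedRung`: Markov counting at
FIXED ε against E(N)/N → e ≤ e∞),
entered after birth as the registered skeleton stub of D.
Lean: `Summit.AtomisticToContinuum.Crystallization.Theses.BarlowBlindPricedRungs.DefectiveCase`

## Assembly
Pure logic plus the parent's certified deciding theorem: `defectiveCase_of_pieces` (two
`Classical.byCases` per sequence, on
«∃ᶠ N, 1/2 ≤ b_N(x)» — negation `Filter.not_frequently` — and on clean-window recurrence) turns D,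
C, U into the parent's P₁, and
`BarlowBlindPricedRungs.closes P₀ P₁ P₂ : Crystallization` (hull criterion stmt-3243, window
optimality 13962, energy limit 0626)
finishes (deciding theorem `closes` in glue.lean; kernel-checked with the converse pieces in the
node file).

Rationale: WHY THIS LINE. Mechanism: a radius-R energy-splitting rule Φ (IsRule: box + complementarity, so Σ_i
siteE = E(N) along ground states) that is
ε-feasible at every site (siteE ≥ e∞ − ε) and κ-STRICT on two-shell-bad sites turns E(N)/N → e ≤ e∞
(BlancLewin2015, (8), landed)
into the eventual bound b_N < θ for every θ > ε/κ — ONE rung, no ε → 0 limit (kernel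
`eventually_badFrac_lt_of_rung`); the parent
needed the whole ε-uniform ladder (X₁) to make P₁ vacuous, the child needs one rung for the dense
half and isolates the deep-rung
content in U. This is the Delsarte/Cohn–Elkies move (exhibit the dual certificate; HalesDSP2012
finite-radius LPs) applied to DEFECT
DENSITY, with the 2D local-energy proofs (HeitmannRadin1980, Theil2006, arXiv:1605.00034) as model,
the defect-COUNT-from-energy-gap
programme of Tisdell–Choksi–Lu (arXiv:2503.22680, optimal quantizers on closed surfaces) as the
nearest analogue of the counting
step, and Kubin–Ponsiglione (arXiv:2004.06820, tail energy of hard spheres enforces optimal packing)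
for the far-field budget that
the node quantifies as the binding loss of every Barlow-blind certificate (provable blind allowance
≈ 8–10× the continuum hcp far
field 0.539/R₀³). What the line does that prior routes and the negatives index do not: the split
variable is an L¹ density
THRESHOLD tied to one certificate radius (lens-1: sup-norm covering density; lens-2: matrix
morphology; lens-4: recurrence and
number density of the limit object), no single-shell rigidity (15929, 4146 refuted), no
linear-in-mismatch pricing (17253 refuted:
fixed tolerance 1/20, scale window), no gluing of windows (3506).

RANKED CRUXES. #2 DenseDefectiveCase (crux) — for every sequence x of Lennard-Jones ground states
whose two-shell-bad fraction b_N(x) is FREQUENTLY at least 1/2, x has periodic windows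
(HullMinimality spelling, window W). Necessary (kernel `dense_of_defectiveCase`); door: one priced
rung with ε/κ < 1/2 makes it vacuous (kernel `dense_of_onePricedRung`); INSTRUMENTABLE (M10 priced
LP at δ = 7/10). [difficulty: open-problem] (why it might fail: Consequence of Crystallization, so
only the ATTACK can fail: no rung reaches ε/κ < 1/2 — the provable far-field allowance (≈ 9× the hcp
tail 0.539/R₀³ from 7/10-separation) forces R₀ ≈ 7–8, beyond any enumerable pattern zoo, while κ − ε
≤ 0.0237 caps the price.) [BlancLewin2015, HalesDSP2012, Theil2006, arXiv:2503.22680,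
arXiv:2004.06820, stmt-AtomisticToContinuum-26211, stmt-AtomisticToContinuum-12562]
#3 SparseCleanCase (crux) — for every sequence x of Lennard-Jones ground states whose bad fraction
does not tend to 0, is eventually below 1/2, and along which for every radius ρ clean balls (every
particle within ρ of some centre is two-shell-good) recur, x has periodic windows. Necessary (kernel
`sparseClean_of_defectiveCase`); attack: ground-state strain decay in clean windows (harmonic
regime) followed by lens-1 CleanBallsCase (stmt-25860) / LayeredHull.PeriodicGivenLayered (stacking
selection); structure only, no energy certificate. [difficulty: XL] (why it might fail: Consequence
of Crystallization; the ATTACK fails if clean ground-state windows of radius L need not be η(L)-flat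
with η(L) → 0 (persistent slowly varying strain among good sites) or if the stacking inside clean
windows never repeats a period at the radii asked (e_fcc − e_hcp ≈ 7e-5).) [EMing2006,
FrieseckeTheil2002, HalesDSP2012, stmt-AtomisticToContinuum-25860, stmt-AtomisticToContinuum-26136,
stmt-AtomisticToContinuum-24041]
#4 SparseUniformCase (crux) — for every sequence x of Lennard-Jones ground states whose bad fraction
does not tend to 0, is eventually below 1/2, and along which clean two-shell-good balls of SOME
radius eventually never occur (sparse but uniformly spread defects), x has periodic windows.
Necessary (kernel `sparseUniform_of_defectiveCase`); DECLARED RESIDUAL; natural discharge = vacuity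
by DEEP rungs ε/κ < θ(ρ₀) ≈ (ρ*·4πρ₀³/3)⁻¹ (the ε → 0 end of the 12560/X₁ ladder); partial
structural door: lens-4 Kossel sandwich (vacancy-type defects). [difficulty: open-problem] (why it
might fail: Kernel consequence of Crystallization; as a residual it is the whole difficulty on
ground states with a defect superlattice or persistent texture of density < 1/2 in a Barlow host: no
shallow certificate prices them (needs ε/κ ≈ 5e-3 at spacing 3) and no structural argument forces
clean windows.) [Miekisz1998, BlancLewin2015, FlatleyTheil2015, stmt-AtomisticToContinuum-12560,
stmt-AtomisticToContinuum-26046, Literature.Barriers.AtomisticToContinuum.TetrahedralFrustration]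
#5 StrainedCase (crux) — verbatim parent item stmt-AtomisticToContinuum-26212 (shared binder): for
every sequence x of Lennard-Jones ground states whose two-shell-bad fraction tends to 0 but for
which, for some η > 0, the fraction of particles that are not η-LayeredNear does not tend to 0, x
has periodic windows. Necessary; attacked in the parent (⟸ 24041 StrainRelaxation, ⟸ X₂
FlatPricedRungs). [difficulty: XL] (why it might fail: Kernel consequence of Crystallization; the
ATTACK (24041 / X₂) fails if ground states carry a non-vanishing density of slowly varying strain
gradients or incoherent Barlow junctions among two-shell-good sites whose excess energy per site → 0
(no layering price at any finite radius).) [EMing2006, FrieseckeTheil2002, HalesDSP2012,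
stmt-AtomisticToContinuum-24041, stmt-AtomisticToContinuum-26212]
#9 FractionsFrameAlong (support) — verbatim parent item stmt-AtomisticToContinuum-26213 (shared
binder): if the two-shell-bad fraction tends to 0 and for every η > 0 the non-η-LayeredNear fraction
tends to 0, x has periodic windows (NearFar glue chain LayeredWindows_proof →
PeriodicGivenLayered_of; provable now). [difficulty: provable-now] [stmt-AtomisticToContinuum-26213,
stmt-AtomisticToContinuum-24042, HalesDSP2012]

TWO-LAYER PLAN. D ⇐ OnePricedRung (one radius R, one rule Φ, ε < κ/2; kernel
`dense_of_onePricedRung`) ⇐ EnumerativeRung at δ = 7/10 (the same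
rung on all 7/10-separated finite configurations, what an LP certifies; kernel
`pricedRungBelow_of_enumerative` with the landed
separation theorem) — registered as the BC3 skeleton of D right after birth (stubs: window
certificate, far-field budget).
C ⇐ (StrainDecayInCleanWindows: clean ground-state windows of radius L are η(L)-flat, η(L) → 0) →
CleanBallsCase 25860 → C.
U: no split filed (residual); candidate later split by defect TYPE (vacancy-type ⇐ lens-4 Kossel
sandwich; interstitial / texture
⇐ deep rungs). Dial: `defectiveCase_iff_at θ` for every θ > 0 with monotonicity lemmas, so θ₀ can be
slid to the best certified ε/κ
by a restate without touching C's or U's role.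

KILL CRITERIA. No refutation of D, C or U is possible without refuting `Crystallization` (each is a
kernel consequence): a refuted piece closes the
SUMMIT conjunct negatively. The LINE for D dies if the priced LP (M10) certifies ε/κ ≥ 1/2 at every
radius it can reach AND the
far-field budget cannot be improved below ≈ 4× the hcp tail (then D joins U as deep-rung territory
and the dial is moot); the line
for C dies with lens-1's CleanBallsCase (25860 refuted or exhausted). Proved elsewhere that moots
it: any F1-theorem (bad fraction
→ 0 for all ground states: X₁ TwoShellPricedRungs, CohesionFrustrationStrain 24039 ∧ 24040) makes D,
C, U vacuous at once.

NOT DECOMPOSED YET. The far-field transfer rule (how an over-dense far end pays the far-pair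
attraction), the window certificate's pattern zoo at
R₀ ∈ {2.06, 3}, the ground-state mesoscopic density lemma that would bring R₀ to 3, the strain-decay
lemma for C, and any split of U
— all layer 2, after birth.

CHEAPEST FALSIFIER. T-lens5-g3 (asked of decomp-a2c-census-1, menu M10, 10–30 core-h; not runnable
by this seat, kit_allowed = false): embedded-host
priced LP at δ = 7/10 (only 7/10-separation is proved for ground states), R₀ ∈ {2.06, 3}, price rows
κ ∈ {1e-2, 2e-2} on
¬IsTwoShellGood sites, far field charged by the tail-aware transfer with the provable allowance
τ(R₀); report the smallest certified
ε/κ. ε/κ < 1/2 discharges D; ε/κ ≥ 1/2 at both radii says the dial must move up (restate θ₀) or D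
waits for the density lemma.
Independent cheap check: the census competitor table (j337583) already caps κ − ε ≤ 0.0237.

NUMBERS. V = r⁻¹²/12 − r⁻⁶/6, e_hcp = −0.7175893, ρ* = √2/0.9713³ = 1.5433. Bridge: limsup b_N ≤
ε/κ. Price cap κ − ε ≤ 0.02374 (cheapest
all-bad periodic competitor; glasses ≥ 0.0226, bcc +0.0311, A15 +0.0862) ⇒ θ₀ = 1/2 needs total ε ≲
1.2e-2. Window slack 8.45e-3 at
R = 2.06 (unpriced PART-A zoo, truncation-limited). Far field: hcp continuum g(R₀) = ρ*π/(9R₀³) =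
0.539/R₀³ per site (8.4e-3 at 4,
2.5e-3 at 6); provable blind allowance from 7/10-separation (disjoint 7/20-balls, Stieltjes worst
case) τ(R₀) = 7.4e-2 / 3.6e-2 /
2.0e-2 / 1.3e-2 / 8.4e-3 at R₀ = 4 / 5 / 6 / 7 / 8 (≈ 8–10 g) ⇒ blind R₀ ≈ 7–8; tail-aware transfer
removes the pile-up atom (×4):
R₀ ≈ 6; Hales/dodecahedral constants ×0.74 (not in Literature); mesoscopic density lemma ⇒ R₀ ≈ 3 (≈
170-site window). Deep-rung
threshold for U: θ(ρ₀) ≈ (ρ*·4πρ₀³/3)⁻¹ = 5.7e-3 at ρ₀ = 3. Hard core: 7/10 (p115815), 1/3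
(LennardJonesMinimalDistance_holds).

DEFINITION REQUESTS. None: all pieces are closed Props over existing declarations (IsTwoShellGood,
PeriodicConfiguration, IsGroundState, lennardJones,
barlowPoint for the shared binders).

Novelty: Searches (2026-08-30, this generation): lit search --hybrid "defect density bound ground state
Lennard-Jones local energy inequality Markov fraction of defects" -n 8 (8 books: sethna2021,
kleman2003, cai2016 …, none on point); lit vsearch "the fraction of atoms in non-crystalline local
environments in an energy minimizer is bounded by the energy deficit divided by the local energy
gap" -k 8 (alicandro2023 p.31 discrete interfaces, debenedetti2020; no theorem of this shape); lit
galaxy search "defect density|energy per particle gap|local energy inequality" --star pdf -n 8 (0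
relevant); lit galaxy search "Lennard-Jones ground state|crystallization conjecture" --star pdf -n 8
(Tisdell–Choksi–Lu pdf:4139099877581037660, Bétermin hal-01400869, Leblé thesis, CKMRV
pdf:4729317813722291780, MFO 49/2018, Kubin–Ponsiglione pdf:-8874958118768162640); lit search "Theil
crystallization local energy defect fraction" --source local (arxiv-1504.01153 p24 review; relaxed
matches only); parent generation's searches (route BarlowBlindPricedRungs NOVELTY) carried; ledger
negatives --problem AtomisticToContinuum (read in g2, 4 on this conjunct).
Nearest prior art found: [galaxy:pdf:4139099877581037660 p.1,3] Tisdell–Choksi–Lu arXiv:2503.22680 —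
upper bounds on the NUMBER OF DEFECTS of energy minimisers from a lower bound on the energy plus a
matching construction (2D quantizers; the counting step of this route in another model);
[galaxy:pdf:-8874958118768162640 p.1,4] Kubin–Ponsiglione arXiv:2004  [refs: 2503.22680, 2004.06820, arxiv-1504.01153, paper:arxiv-1605.00034, Theil2006, FlatleyTheil2015, HalesDSP2012]

Barriers (technique_class: priced splitting certificates, Markov density dial): - technique_class: priced splitting certificates, Markov density dial
- Literature.Barriers.AtomisticToContinuum.TetrahedralFrustration: bites only the price side of D's
door (locally icosahedral/tetrahedral packing is cheaper per site, so κ is capped ≈ 2.4e-2 and no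
radius-1 strict rule exists); the bet is that frustration cannot tile space, so a radius-R₀ rule
sees the forced price; D, C, U themselves assert no local statement.
- Literature.Barriers.AtomisticToContinuum.IcosahedralClusters: same placement; no single-shell or
cluster price is claimed; strictness is per site but read over whole R₀-neighbourhoods.
- Literature.Barriers.AtomisticToContinuum.DecahedralSoftShell: same; soft decahedral shells are
two-shell-bad rows the certificate must price collectively; a zero price at accessible R₀ is the
stated falsifier, not a contradiction.
- Literature.Barriers.AtomisticToContinuum.KissingTwelveDegeneracy: evaded — goodness is TWO-shell
with a radial scale window, never inferred from twelve touching neighbours.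
- Literature.Barriers.AtomisticToContinuum.FlexibleKissingArrangements: evaded the same way; the
tolerance box 1/20 is fixed (no τ → 0 limit, cf. 17253).
- Literature.Barriers.AtomisticToContinuum.ShortRangeStackingBlindness: discharged by design
(Barlow-blind): no certificate distinguishes polytypes; PeriodicWindows admits any periodic
polytype; stacking selection sits inside C's attack (PeriodicGivenLayered, landed) and is named
there as the failure mode.
- Literat

sub-problem: Crystallization · status: open · opened planner-decomp-a2c-lens-5-g3-0 2026-08-30T04:30:41Z · rev 0 · ledger route-AtomisticToContinuum-DefectDensityDial
GENERATED by the gate from the ledger (D-0016/17). Provers cite these decls: `theorem foo : Summit.AtomisticToContinuum.Crystallization.Theses.DefectDensityDial.<Decl> := …` in Summits/AtomisticToContinuum/Crystallization/Theorems/<Name>.lean.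
-/

namespace Summit.AtomisticToContinuum.Crystallization.Theses.DefectDensityDial

open scoped BigOperators Topology Manifold Classical MeasureTheory ProbabilityTheory Matrix InnerProductSpace ComplexConjugate ContinuousMap
open Filter Set Function TopologicalSpace MeasureTheory

attribute [summit_statement] _root_.Crystallization

/-- item stmt-AtomisticToContinuum-27755 · crux · rank 2 · open · by planner
why it might fail: Consequence of Crystallization, so only the ATTACK can fail: no rung reaches ε/κ < 1/2 — the provable far-field allowance (≈ 9× the hcp tail 0.539/R₀³ from 7/10-separation) forces R₀ ≈ 7–8, beyond any enumerable pattern zoo, while κ − ε ≤ 0.0237 caps the price.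
sources: BlancLewin2015, HalesDSP2012, Theil2006, arXiv:2503.22680, arXiv:2004.06820, stmt-AtomisticToContinuum-26211
[crux] for every sequence x of Lennard-Jones ground states whose two-shell-bad fraction b_N(x) is
FREQUENTLY at least 1/2, x has periodic windows (HullMinimality spelling, window W). Necessary
(kernel `dense_of_defectiveCase`); door: one priced rung with ε/κ < 1/2 makes it vacuous (kernel
`dense_of_onePricedRung`); INSTRUMENTABLE (M10 priced LP at δ = 7/10). [difficulty: open-problem] -/
@[route_item "route-AtomisticToContinuum-DefectDensityDial", crux]
def DenseDefectiveCase : Prop :=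
  ∀ x : (N : ℕ) → (Fin N → EuclideanSpace ℝ (Fin 3)), (∀ N, Literature.MathematicalPhysics.StatisticalMechanics.IsGroundState Literature.MathematicalPhysics.StatisticalMechanics.lennardJones (x N)) → (∃ᶠ N in Filter.atTop, (1 / 2 : ℝ) ≤ (Nat.card {i : Fin N // ¬ Literature.Geometry.DiscreteGeometry.IsTwoShellGood (1 / 20) (47 / 50) 1 (x N) i} : ℝ) / N) → ∃ W : Literature.MathematicalPhysics.StatisticalMechanics.PeriodicConfiguration 3, ∀ R ε : ℝ, 0 < ε → ∃ᶠ N in Filter.atTop, ∃ t : EuclideanSpace ℝ (Fin 3), (∀ s ∈ W.points, ‖s‖ ≤ R → ∃ i : Fin N, dist (x N i + t) s ≤ ε) ∧ (∀ i : Fin N, ‖x N i + t‖ ≤ R → ∃ s ∈ W.points, dist (x N i + t) s ≤ ε)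

/-- item stmt-AtomisticToContinuum-27756 · crux · rank 3 · open · by planner
why it might fail: Consequence of Crystallization; the ATTACK fails if clean ground-state windows of radius L need not be η(L)-flat with η(L) → 0 (persistent slowly varying strain among good sites) or if the stacking inside clean windows never repeats a period at the radii asked (e_fcc − e_hcp ≈ 7e-5).
sources: EMing2006, FrieseckeTheil2002, HalesDSP2012, stmt-AtomisticToContinuum-25860, stmt-AtomisticToContinuum-26136, stmt-AtomisticToContinuum-24041
[crux] for every sequence x of Lennard-Jones ground states whose bad fraction does not tend to 0, is
eventually below 1/2, and along which for every radius ρ clean balls (every particle within ρ of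
some centre is two-shell-good) recur, x has periodic windows. Necessary (kernel
`sparseClean_of_defectiveCase`); attack: ground-state strain decay in clean windows (harmonic
regime) followed by lens-1 CleanBallsCase (stmt-25860) / LayeredHull.PeriodicGivenLayered (stacking
selection); structure only, no energy certificate. [difficulty: XL] -/
@[route_item "route-AtomisticToContinuum-DefectDensityDial", crux]
def SparseCleanCase : Prop :=
  ∀ x : (N : ℕ) → (Fin N → EuclideanSpace ℝ (Fin 3)), (∀ N, Literature.MathematicalPhysics.StatisticalMechanics.IsGroundState Literature.MathematicalPhysics.StatisticalMechanics.lennardJones (x N)) → ¬ Filter.Tendsto (fun N : ℕ => (Nat.card {i : Fin N // ¬ Literature.Geometry.DiscreteGeometry.IsTwoShellGood (1 / 20) (47 / 50) 1 (x N) i} : ℝ) / N) Filter.atTop (nhds 0) → (∀ᶠ N in Filter.atTop, (Nat.card {i : Fin N // ¬ Literature.Geometry.DiscreteGeometry.IsTwoShellGood (1 / 20) (47 / 50) 1 (x N) i} : ℝ) / N < 1 / 2) → (∀ ρ : ℝ, ∃ᶠ N in Filter.atTop, ∃ i : Fin N, ∀ j : Fin N, dist (x N j) (x N i) ≤ ρ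 → Literature.Geometry.DiscreteGeometry.IsTwoShellGood (1 / 20) (47 / 50) 1 (x N) j) → ∃ W : Literature.MathematicalPhysics.StatisticalMechanics.PeriodicConfiguration 3, ∀ R ε : ℝ, 0 < ε → ∃ᶠ N in Filter.atTop, ∃ t : EuclideanSpace ℝ (Fin 3), (∀ s ∈ W.points, ‖s‖ ≤ R → ∃ i : Fin N, dist (x N i + t) s ≤ ε) ∧ (∀ i : Fin N, ‖x N i + t‖ ≤ R → ∃ s ∈ W.points, dist (x N i + t) s ≤ ε)

/-- item stmt-AtomisticToContinuum-27757 · crux · rank 4 · open · by planner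
why it might fail: Kernel consequence of Crystallization; as a residual it is the whole difficulty on ground states with a defect superlattice or persistent texture of density < 1/2 in a Barlow host: no shallow certificate prices them (needs ε/κ ≈ 5e-3 at spacing 3) and no structural argument forces clean windows.
sources: Miekisz1998, BlancLewin2015, FlatleyTheil2015, stmt-AtomisticToContinuum-12560, stmt-AtomisticToContinuum-26046, Literature.Barriers.AtomisticToContinuum.TetrahedralFrustration
[crux] for every sequence x of Lennard-Jones ground states whose bad fraction does not tend to 0, is
eventually below 1/2, and along which clean two-shell-good balls of SOME radius eventually never
occur (sparse but uniformly spread defects), x has periodic windows. Necessary (kernel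
`sparseUniform_of_defectiveCase`); DECLARED RESIDUAL; natural discharge = vacuity by DEEP rungs ε/κ
< θ(ρ₀) ≈ (ρ*·4πρ₀³/3)⁻¹ (the ε → 0 end of the 12560/X₁ ladder); partial structural door: lens-4
Kossel sandwich (vacancy-type defects). [difficulty: open-problem] -/
@[route_item "route-AtomisticToContinuum-DefectDensityDial", crux]
def SparseUniformCase : Prop :=
  ∀ x : (N : ℕ) → (Fin N → EuclideanSpace ℝ (Fin 3)), (∀ N, Literature.MathematicalPhysics.StatisticalMechanics.IsGroundState Literature.MathematicalPhysics.StatisticalMechanics.lennardJones (x N)) → ¬ Filter.Tendsto (fun N : ℕ => (Nat.card {i : Fin N // ¬ Literature.Geometry.DiscreteGeometry.IsTwoShellGood (1 / 20) (47 / 50) 1 (x N) i} : ℝ) / N) Filter.atTop (nhds 0) → (∀ᶠ N in Filter.atTop, (Nat.card {i : Fin N // ¬ Literature.Geometry.DiscreteGeometry.IsTwoShellGood (1 / 20) (47 / 50) 1 (x N) i} : ℝ) / N < 1 / 2) → ¬ (∀ ρ : ℝ, ∃ᶠ N in Filter.atTop, ∃ i : Fin N, ∀ j : Fin N, dist (x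 N j) (x N i) ≤ ρ → Literature.Geometry.DiscreteGeometry.IsTwoShellGood (1 / 20) (47 / 50) 1 (x N) j) → ∃ W : Literature.MathematicalPhysics.StatisticalMechanics.PeriodicConfiguration 3, ∀ R ε : ℝ, 0 < ε → ∃ᶠ N in Filter.atTop, ∃ t : EuclideanSpace ℝ (Fin 3), (∀ s ∈ W.points, ‖s‖ ≤ R → ∃ i : Fin N, dist (x N i + t) s ≤ ε) ∧ (∀ i : Fin N, ‖x N i + t‖ ≤ R → ∃ s ∈ W.points, dist (x N i + t) s ≤ ε)

/-- item stmt-AtomisticToContinuum-26212 · crux · rank 5 · open · by planner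
why it might fail: Kernel consequence of Crystallization; the ATTACK (24041 / X₂) fails if ground states carry a non-vanishing density of slowly varying strain gradients or incoherent Barlow junctions among two-shell-good sites whose excess energy per site → 0 (no layering price at any finite radius).
sources: EMing2006, FrieseckeTheil2002, HalesDSP2012, stmt-AtomisticToContinuum-24041, stmt-AtomisticToContinuum-26212
[crux] for every sequence x of Lennard-Jones ground states whose two-shell-bad fraction tends to 0
but for which, for some η > 0, the fraction of particles that are not η-LayeredNear (stmt-24041
text) does not tend to 0, x has periodic windows. Exact complement of F2 given F1; necessary (kernel
`strainedCase_of_periodicWindows`); implied VERBATIM by lens-6's StrainRelaxation stmt-24041 (kernel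
`strainedCase_of_strainRelaxation`) and by X₂ FlatPricedRungs (kernel
`strainedCase_of_flatPricedRungs`). [difficulty: XL] -/
@[route_item "route-AtomisticToContinuum-DefectDensityDial", crux]
def StrainedCase : Prop :=
  ∀ x : (N : ℕ) → (Fin N → EuclideanSpace ℝ (Fin 3)), (∀ N, Literature.MathematicalPhysics.StatisticalMechanics.IsGroundState Literature.MathematicalPhysics.StatisticalMechanics.lennardJones (x N)) → Filter.Tendsto (fun N : ℕ => (Nat.card {i : Fin N // ¬ Literature.Geometry.DiscreteGeometry.IsTwoShellGood (1 / 20) (47 / 50) 1 (x N) i} : ℝ) / N) Filter.atTop (nhds 0) → ¬ (∀ η : ℝ, 0 < η → Filter.Tendsto (fun N : ℕ => ((Finset.univ.filter fun i : Fin N => ¬ (∃ (A : EuclideanSpace ℝ (Fin 3) →ₗᵢ[ℝ] EuclideanSpace ℝ (Fin 3)) (t : EuclideanSpace ℝ (Fin 3)) (a : ℝ) (s : ℤ → ℤ) (z : ℤ → ℝ), (47 / 50 ≤ a ∧ a ≤ 1 ∧ ∀ m : ℤ, 39 / 50 * a ≤ z (m + 1) - z m ∧ z (m + 1) - z m ≤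 17 / 20 * a) ∧ Literature.MathematicalPhysics.StatisticalMechanics.IsHaggSeq s ∧ let S : Set (EuclideanSpace ℝ (Fin 3)) := Set.range fun l : ℤ × ℤ × ℤ => A (((l.2.1 : ℝ) • Literature.MathematicalPhysics.StatisticalMechanics.triangularVec₁ a) + ((l.2.2 : ℝ) • Literature.MathematicalPhysics.StatisticalMechanics.triangularVec₂ a) + ((Literature.MathematicalPhysics.StatisticalMechanics.haggLabel s l.1 : ℝ) • Literature.MathematicalPhysics.StatisticalMechanics.barlowOffset a) + (z l.1 • Literature.MathematicalPhysics.StatisticalMechanics.layerNormal 1)); (∀ j : Fin N, dist (x N j) (x N i) ≤ 2 → ∃ p ∈ S, dist (x N j + t) p ≤ η) ∧ (∀ p ∈ S, dist p (x N i + t) ≤ 2 → ∃ j : Fin N, dist (x N j + t) p ≤ η))).card : ℝ) / N) Filter.atTop (nhds 0)) → ∃ W : Literature.MathematicalPhysics.StatisticalMechanics.PeriodicConfiguration 3, ∀ R ε : ℝ, 0 < ε → ∃ᶠ N in Filter.atTop, ∃ t : EuclideanSpace ℝ (Fin 3), (∀ s ∈ W.points, ‖s‖ ≤ R → ∃ i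 : Fin N, dist (x N i + t) s ≤ ε) ∧ (∀ i : Fin N, ‖x N i + t‖ ≤ R → ∃ s ∈ W.points, dist (x N i + t) s ≤ ε)

/-- item stmt-AtomisticToContinuum-26213 · support · rank 9 · open · by planner
sources: stmt-AtomisticToContinuum-26213, stmt-AtomisticToContinuum-24042, HalesDSP2012
[support] for every sequence x of Lennard-Jones ground states, if the two-shell-bad fraction tends
to 0 and for every η > 0 the non-η-LayeredNear fraction tends to 0, then x has periodic windows (the
per-sequence form of lens-6's frame stmt-24042 / the NearFar glue chain LayeredWindows_proof →
PeriodicGivenLayered_of; provable now, one `exact` once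
Theorems.PhononSlackCertificatesNearFarGlueRRouteNeeds rebuilds). [difficulty: provable-now] -/
@[route_item "route-AtomisticToContinuum-DefectDensityDial", crux]
def FractionsFrameAlong : Prop :=
  ∀ x : (N : ℕ) → (Fin N → EuclideanSpace ℝ (Fin 3)), (∀ N, Literature.MathematicalPhysics.StatisticalMechanics.IsGroundState Literature.MathematicalPhysics.StatisticalMechanics.lennardJones (x N)) → Filter.Tendsto (fun N : ℕ => (Nat.card {i : Fin N // ¬ Literature.Geometry.DiscreteGeometry.IsTwoShellGood (1 / 20) (47 / 50) 1 (x N) i} : ℝ) / N) Filter.atTop (nhds 0) → (∀ η : ℝ, 0 < η → Filter.Tendsto (fun N : ℕ => ((Finset.univ.filter fun i : Fin N => ¬ (∃ (A : EuclideanSpace ℝ (Fin 3) →ₗᵢ[ℝ] EuclideanSpace ℝ (Fin 3)) (t : EuclideanSpace ℝ (Fin 3)) (a : ℝ) (s : ℤ → ℤ) (z : ℤ → ℝ), (47 / 50 ≤ a ∧ a ≤ 1 ∧ ∀ m : ℤ, 39 / 50 * a ≤ z (m + 1) - z m ∧ z (m + 1) - z m ≤ 17 / 20 * a) ∧ Literature.MathematicalPhysics.StatisticalMechanics.IsHaggSeq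 s ∧ let S : Set (EuclideanSpace ℝ (Fin 3)) := Set.range fun l : ℤ × ℤ × ℤ => A (((l.2.1 : ℝ) • Literature.MathematicalPhysics.StatisticalMechanics.triangularVec₁ a) + ((l.2.2 : ℝ) • Literature.MathematicalPhysics.StatisticalMechanics.triangularVec₂ a) + ((Literature.MathematicalPhysics.StatisticalMechanics.haggLabel s l.1 : ℝ) • Literature.MathematicalPhysics.StatisticalMechanics.barlowOffset a) + (z l.1 • Literature.MathematicalPhysics.StatisticalMechanics.layerNormal 1)); (∀ j : Fin N, dist (x N j) (x N i) ≤ 2 → ∃ p ∈ S, dist (x N j + t) p ≤ η) ∧ (∀ p ∈ S, dist p (x N i + t) ≤ 2 → ∃ j : Fin N, dist (x N j + t) p ≤ η))).card : ℝ) / N) Filter.atTop (nhds 0)) → ∃ W : Literature.MathematicalPhysics.StatisticalMechanics.PeriodicConfiguration 3, ∀ R ε : ℝ, 0 < ε → ∃ᶠ N in Filter.atTop, ∃ t : EuclideanSpace ℝ (Fin 3), (∀ s ∈ W.points, ‖s‖ ≤ R → ∃ i : Fin N, dist (x N i + t) s ≤ ε) ∧ (∀ i : Fin N, ‖x N i +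 t‖ ≤ R → ∃ s ∈ W.points, dist (x N i + t) s ≤ ε)

/-- item stmt-AtomisticToContinuum-27758 · assembly · rank 1 · open · by planner
sources: stmt-AtomisticToContinuum-26211, stmt-AtomisticToContinuum-3243
[assembly] P₀ → P₂ → D → C → U → Crystallization -/
@[route_item "route-AtomisticToContinuum-DefectDensityDial"]
def Assembly : Prop :=
  FractionsFrameAlong → StrainedCase → DenseDefectiveCase → SparseCleanCase → SparseUniformCase → _root_.Crystallization

/-! D-0027 §2.1 — DECIDING THEOREM (planner-authored via `route open/edit --closes-file`; by planner-decomp-a2c-lens-5-g3-0 2026-08-30T04:30:41Z):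
its hypotheses are this route's items and its conclusion the sub-problem Statement (glue_lint), and it elaborates with this file. -/

@[closes "route-AtomisticToContinuum-DefectDensityDial"] theorem closes (h_FractionsFrameAlong : FractionsFrameAlong) (h_StrainedCase : StrainedCase)
    (h_DenseDefectiveCase : DenseDefectiveCase) (h_SparseCleanCase : SparseCleanCase)
    (h_SparseUniformCase : SparseUniformCase) : _root_.Crystallization := by
  -- The parent route's certified deciding theorem (route-AtomisticToContinuum-BarlowBlindPricedRungs, `closes`):
  -- P₀ (FractionsFrameAlong) → P₁ (DefectiveCase, the parent's declared residual) → P₂ (StrainedCase) → Crystallization.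
  -- This child route REFINES P₁: per ground-state sequence, excluded middle on «bad fraction ≥ 1/2 frequently» and then on
  -- «clean two-shell-good balls of every radius recur» dispatches P₁ to D (dense), C (sparse-clean) or U (sparse-uniform).
  refine _root_.Summit.AtomisticToContinuum.Crystallization.Theses.BarlowBlindPricedRungs.closes
    (fun x hx h1 h2 => h_FractionsFrameAlong x hx h1 h2) ?_ (fun x hx h1 h2 => h_StrainedCase x hx h1 h2)
  intro x hx hnt
  by_cases hfreq : ∃ᶠ N in Filter.atTop, (1 / 2 : ℝ) ≤
      (Nat.card {i : Fin N // ¬ Literature.Geometry.DiscreteGeometry.IsTwoShellGood (1 / 20) (47 / 50) 1 (x N) i} : ℝ) / N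
  · exact h_DenseDefectiveCase x hx hfreq
  · have hev : ∀ᶠ N in Filter.atTop,
        (Nat.card {i : Fin N // ¬ Literature.Geometry.DiscreteGeometry.IsTwoShellGood (1 / 20) (47 / 50) 1 (x N) i} : ℝ) / N
          < 1 / 2 :=
      (Filter.not_frequently.1 hfreq).mono fun N h => not_le.1 h
    by_cases hcw : ∀ ρ : ℝ, ∃ᶠ N in Filter.atTop, ∃ i : Fin N, ∀ j : Fin N, dist (x N j) (x N i) ≤ ρ →
        Literature.Geometry.DiscreteGeometry.IsTwoShellGood (1 / 20) (47 / 50) 1 (x N) j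
    · exact h_SparseCleanCase x hx hnt hev hcw
    · exact h_SparseUniformCase x hx hnt hev hcw

end Summit.AtomisticToContinuum.Crystallization.Theses.DefectDensityDial
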